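import Summits.BirchSwinnertonDyer.BirchSwinnertonDyer.Theorems.ThetaPartnerAtTwoSignedKatoUpToAtTwoOmegaDivisionCharValues
import Summits.BirchSwinnertonDyer.BirchSwinnertonDyer.Theorems.ThetaPartnerAtTwoSignedKatoUpToAtTwoCoreOfFiniteErl
import Literature.NumberTheory.EllipticCurves.PlusMinusPAdicLFunction
import HarnessLib

/-!
# Route `ThetaPartnerAtTwo` (TP2), crux K3 `SignedKatoDivisibilityUpToAtTwo` (item stmt-BirchSwinnertonDyer-20308) /
# K3P′ (stmt-BirchSwinnertonDyer-25631), line `colemanrat` v11 — the PUB stub CORE_fin ⟸ its CHARACTER-VALUE form CORE_χ: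
# «values at the characters of `G_n` ⟹ congruence modulo `ω_n`» made kernel

Width seat `bsd-wall-tp2-p2x-w3` g6 (cell `bsd-wall`). HONEST FRAMING: theorems only (no definition, no named fact, no
instance, no `sorry`); pure `Λ = ℤ_p⟦T⟧`-algebra plus two implications between fully spelled statements; closes no item;
K3 / K3P′ are NOT settled and BSD is NOT proved by any of this.

## Why this file

Skeleton v11 of line `colemanrat` has ONE research stub, `stub_katoFiniteErlTwo` = CORE_fin = the hypothesis `hfin` of
`SignedKatoOffTwo.CoreFin.core_of_coreFin` (`…CoreOfFiniteErl.lean`): Kato's `2`-adic zeta element `s` with the FINITE-LEVEL explicit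
reciprocity law (ERL_fin) «`∃ μ ν ∈ Λ ∖ 𝔭 ∀ n ∃ m q : 2^m (μ·θ_n − ν·P_{n,d_n}(col₀ s)) = ω_n · q`», a CONGRUENCE modulo
`ω_n = (1+T)^{2ⁿ} − 1` in `Λ ⊗ ℚ₂`. What is PRINTED is one level more concrete — values at the CHARACTERS `ψ` of
`G_n = Gal(ℚ_n/ℚ)`: Kato, Astérisque 295, Thm. 12.5 (1) / Thm. 6.6 + 9.7 («`∑_σ ψ(σ) exp*(σ z) = L_{S}(f, ψ, 1)·(period)`»; the
tree's fact `Kato2004.exists_eulerSystem_expStar_values` is per character), Kobayashi 2003 p. 25 (proof of Thm. 6.3: «`ψ(P_n(z)) =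
τ(ψ) … L(E, ψ̄, 1)/Ω`»), Kurihara 2002 §3, and on the Mazur–Tate side Birch's formula `ψ(θ_n) = θ_n(ψ(γ) − 1) = ∑_a ψ(a)[a/2^{n+2}]⁺`
(tree: `eval₂_mazurTateElement_eq_ratTwistedSymbolSum`). The passage «equal values at every `ψ` ⟹ congruent modulo `ω_n`»
(lead memo `G6-LEAD-v11.md` §3, third bullet, "hence … for every character ψ of `G_n` ⟹ `P_n(z_Kato) ≡ r·θ_n (mod ω_n)`") was not
in the tree — only its converse `IsCongrModOmega.eval₂_eq`. This file proves it (Weierstrass division by the distinguished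
polynomial `ω_n`, Washington Prop. 7.2, + «a polynomial of degree `< pⁿ` with `pⁿ` roots is `0`»; §1–§2, the PREQUEL
`…OmegaDivisionCharValues.lean`, same namespace) and re-sockets the stub (§3, THIS file):

* §1 (any prime `p`) `toIwasawa_cyclotomicOmega_dvd_of_forall_eval_eq_zero`: **`H ∈ Λ` with `H(ζ − 1) = 0` for every `ζ ∈ ℂ_p`,
  `ζ^{pⁿ} = 1` ⟹ `ω_n ∣ H` in `Λ`**; `exists_C_pow_mul_sub_eq_omega_mul_of_forall_eval`: for `θ ∈ ℚ[T]`, `A, B ∈ Λ`,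
  «`A(ζ−1)·θ(ζ−1) = B(ζ−1)` for all `ζ^{pⁿ} = 1`» ⟹ «`∃ m q : p^m (ι(A)·θ − ι(B)) = ι(ω_n q)`» (the (ERL_fin)/`IsCongrModOmega` shape;
  the `p`-power clears the denominators of `θ`, `memIwasawaRat_of_forall_norm_coeff_le`); and the converse
  `forall_eval_of_C_pow_mul_sub_eq_omega_mul`.
* §2 (`p = 2`) `exists_even_char_apply_cyclotomicGenerator_eq`: every `ζ ∈ ℂ₂` with `ζ^{2ⁿ} = 1` is `χ(γ)`, `γ = 5`, for an EVEN
  Dirichlet character `χ` modulo `2^{n+2}` of `2`-power order (a character of `G_n`): powers of one primitive such character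
  (`exists_isPrimitive_even_orderOf_eq_prime_pow`, `orderOf_apply_cyclotomicGenerator`).
* §3 (`p = 2`, the socket) **`core_fin_of_coreChi : CORE_χ → CORE_fin`** and `coreChi_of_coreFin : CORE_fin → CORE_χ`, where CORE_χ is
  CORE_fin (= the registered stub `stub_katoFiniteErlTwo`, VERBATIM as conclusion) with (ERL_fin) REPLACED by
  (ERL_χ) «`∃ μ ν ∈ Λ ∖ 𝔭 ∀ n ∀ χ` (even, `2`-power order, mod `2^{n+2}`):
  `ν(χ(γ)−1) · P_{n,d_n}(col₀ s)(χ(γ)−1) = μ(χ(γ)−1) · ratTwistedSymbolSum f χ`», values in `ℂ₂`, `F(z) := ∑_k ι(F_k) z^k` for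
  `F ∈ Λ` (so `P_{n,d_n}(col₀ s)(χ(γ)−1) = ∑_{j<2ⁿ} ⟨col₀ s, gʲ d_n⟩ χ(γ)ʲ = χ(P_{n,d_n}(col₀ s))`, the character applied to Kurihara's
  group-ring element, and `ratTwistedSymbolSum f χ = ∑_a χ(a)[a/2^{n+2}]⁺_f = χ(θ_n)`).
  So on line `colemanrat` v11: **`stub_katoFiniteErlTwo` ⟸ CORE_χ** (`core_fin_of_coreChi`), CORE ⟸ CORE_χ
  (`CoreFin.core_of_coreFin ∘ core_fin_of_coreChi`), K3P′ ⟸ CORE_χ (`CoreFin.signedKatoDivisibilityUpToAtTwoOfPub_of_coreFin ∘ …`).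

What this does NOT do: prove (ERL_χ) (PUB: Kato's zeta element at `2` + the local `exp*`/`log` dictionary of Kobayashi §8.5–8.6 at
`2`), hence not CORE_fin, not K3, not BSD. The sockets CORE_fin (w2 g5), MTV-CORE (lead g6), CORE_Col (w2 g5) and CORE_χ (here) are
equivalent re-phrasings of the same published input; a typer may target whichever matches the printed sentence best — CORE_χ is the
one in which Kato's Thm. 12.5 (1) and Birch's formula are literally character-by-character.

References: [Kato2004Asterisque] Thm. 6.6 (p. 163), Thm. 9.7 (p. 189), Thm. 12.5 (1) (pp. 221–222); [Kobayashi2003] Thm. 6.3 and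
its proof (p. 25), (8.23), Prop. 8.25; [Kurihara2002] §3; [Pollack2003] Prop. 6.9 (proof), Prop. 6.18 (proof); [Washington1997]
§7.1 Prop. 7.2 (Weierstrass division), §7.2; [MazurTateTeitelbaum1986Invent] §I.12–I.13.
-/

set_option autoImplicit false
-- the Theorems namespace of this sub repeats the summit name by design (D-0017 nested layout)
set_option linter.dupNamespace false

noncomputable section

open scoped Classical MatrixGroups ModularForm NumberField

open CongruenceSubgroup WeierstrassCurve Field IsDedekindDomain NumberField Polynomial
  Literature.NumberTheory.GaloisRepresentations
  Literature.NumberTheory.EllipticCurves Literature.NumberTheory.EllipticCurves.ModularForms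
  Literature.NumberTheory.EllipticCurves.Module Literature.NumberTheory.EllipticCurves.Rank1Residual
  Literature.NumberTheory.EllipticCurves.Kobayashi2003 Literature.NumberTheory.EllipticCurves.Kato2004
  Literature.NumberTheory.EllipticCurves.Kato2004.EulerSystemValues Literature.NumberTheory.EllipticCurves.GreenbergSelmer
  Literature.NumberTheory.EllipticCurves.Sprung2012 Literature.NumberTheory.EllipticCurves.Sprung2017
  ZpExtension Summit.BirchSwinnertonDyer.Rank1Residual.Supersingular

namespace Summit.BirchSwinnertonDyer.BirchSwinnertonDyer.Theorems.SignedKatoOffTwo.CoreChi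

/-! ## §3 The socket: CORE_fin (the registered PUB stub `stub_katoFiniteErlTwo`) ⟸ CORE_χ, and conversely (`p = 2`) -/

section Socket

/-- Bounded coefficients of `Λ`-elements pushed to `ℂ₂` (plumbing). [folklore] -/
private theorem hbd_two (G : PowerSeries ℤ_[2]) (k : ℕ) :
    ‖((algebraMap ℚ_[2] ℂ_[2]).comp (algebraMap ℤ_[2] ℚ_[2])) (PowerSeries.coeff k G)‖ ≤ 1 :=
  norm_algebraMap_coeff_le_one G k

/-- **CORE_fin ⟸ CORE_χ.** Hypothesis CORE_χ: the registered PUB stub `stub_katoFiniteErlTwo` of line `colemanrat` v11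
(= CORE_fin = `hfin` of `CoreFin.core_of_coreFin`) with its last conjunct (ERL_fin) REPLACED by the CHARACTER-VALUE law
(ERL_χ): «for every glue `col₀` of THE pairing `pair` along `I.proj` there are `μ, ν ∈ Λ = ℤ₂⟦T⟧`, both `∉ 𝔭`, such that for
every layer `n ≥ 0` and every EVEN Dirichlet character `χ` modulo `2^{n+2}` of `2`-power order (a character of `G_n = Gal(ℚ_n/ℚ)`,
`γ = 5 ↦ χ(γ) ∈ μ_{2ⁿ}`):  `ν(χ(γ) − 1) · χ(P_{n,d_n}(col₀ s)) = μ(χ(γ) − 1) · ∑_{a mod 2^{n+2}} χ(a) [a/2^{n+2}]⁺_f`»,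
where `F(z) = ∑_k ι(F_k) z^k ∈ ℂ₂` for `F ∈ Λ`, `χ(P_{n,d_n}(z)) = P_{n,d_n}(z)(χ(γ) − 1) = ∑_{j<2ⁿ} z(gʲ d_n) χ(γ)ʲ` is the character
`χ` applied to Kurihara's/Kobayashi's group-ring element `P_{n,d_n}(z) = ∑_σ ⟨z, σ d_n⟩ σ ∈ ℤ₂[G_n]` (`Sprung2012.pairingSum`,
Def. 3.1 = Kobayashi (8.23)), and `∑_a χ(a)[a/2^{n+2}]⁺_f = ratTwistedSymbolSum f χ = χ(θ_n)` (Birch; tree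
`eval₂_mazurTateElement_eq_ratTwistedSymbolSum`). This is the currency of Kato Thm. 12.5 (1) / 6.6 + 9.7 and of Kobayashi's proof of
Thm. 6.3 (p. 25), character by character. Conclusion: CORE_fin VERBATIM (the registered stub's text). Proof: §2 (every `ζ^{2ⁿ} = 1` is a
`χ(γ)`) + Birch + §1 `exists_C_pow_mul_sub_eq_omega_mul_of_forall_eval` (values ⟹ congruence mod `ω_n`, Weierstrass division).
CONDITIONAL on the hypothesis only; closes nothing by itself.
[cite: Kato2004Asterisque, Thm. 6.6 (p. 163), Thm. 9.7 (p. 189), Thm. 12.5 (1) (pp. 221–222)] [cite: Kobayashi2003, Thm. 6.3 (proof, p. 25), (8.23), Prop. 8.25]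
[cite: Pollack2003, Prop. 6.9 (proof), Prop. 6.18 (proof)] [cite: Washington1997, §7.1 Prop. 7.2] -/
theorem core_fin_of_coreChi
    (hchi :
      ∀ (v : HeightOneSpectrum (𝓞 ℚ)), ((2 : ℕ) : 𝓞 ℚ) ∈ v.asIdeal →
      ∀ (W : WeierstrassCurve ℚ) [W.IsElliptic] [W.IsGloballyMinimal],
        ¬ W.HasCM → W.analyticRank = 0 → GoodSS W 2 → W.frobeniusTrace 2 = 0 →
        ∀ (κ : ZpExtension ℚ 2) (γ : Field.absoluteGaloisGroup ℚ) (hκ : κ.IsCyclotomic),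
          κ.IsTopGenerator γ → IsCyclotomicVariable 2 γ →
          ∀ [NeZero (W.conductorNorm ℤ)] (f : CuspForm (Gamma0 (W.conductorNorm ℤ)) 2),
            IsNewformOf W f → ∀ (ϖ : ℚ), (ϖ : ℝ) * W.realPeriodRat = plusPeriod f →
          ∀ (Lplus Lminus : IwasawaAlgebra 2), IsPollackPair f 2 Lplus Lminus →
          ∀ [ContinuousSMul ℤ_[2] (W.tateModule 2)] [Module.Free ℤ_[2] (W.tateModule 2)]
            [Module.Finite ℤ_[2] (W.tateModule 2)],
          ∀ 𝔭 : PrimeSpectrum (IwasawaAlgebra 2), 𝔭.asIdeal.height = 1 →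
            PowerSeries.C (2 : ℤ_[2]) ∉ 𝔭.asIdeal →
          ∀ (I : Kato2004.IwasawaH1Data W 2 κ γ)
            (pair : ∀ n : ℕ, H1 (tateRep W 2) (κ.layerSubgroup n) →ₗ[ℤ_[2]]
              (localLayerPointsOfEmb κ (closureEmb (K := ℚ) (v.adicCompletion ℚ)) W n →+ ℤ_[2])),
            -- (P1) projection formula
            (∀ (n : ℕ) (x : H1 (tateRep W 2) (κ.layerSubgroup (n + 1))) (Q : localPoints W (v.adicCompletion ℚ))
              (hQ : Q ∈ localLayerPointsOfEmb κ (closureEmb (K := ℚ) (v.adicCompletion ℚ)) W n),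
              pair n (layerCores (tateRep W 2) κ n x) ⟨Q, hQ⟩ =
                pair (n + 1) x ⟨Q, localLayerPointsOfEmb_mono κ (closureEmb (K := ℚ) (v.adicCompletion ℚ)) W (Nat.le_succ n) hQ⟩) →
            -- (P2) Galois invariance, for EVERY `g ∈ Γ_v`
            (∀ (n : ℕ) (g : absoluteGaloisGroup (v.adicCompletion ℚ)) (y : H1 (tateRep W 2) (κ.layerSubgroup n))
              (Q : localPoints W (v.adicCompletion ℚ))
              (hQ : Q ∈ localLayerPointsOfEmb κ (closureEmb (K := ℚ) (v.adicCompletion ℚ)) W n),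
              pair n (conjMap (tateRep W 2).toTopRep (κ.layerSubgroup n) (resGalOfEmb (closureEmb (K := ℚ) (v.adicCompletion ℚ)) g) 1 y)
                ⟨g • Q, smul_mem_localLayerPointsOfEmb κ (closureEmb (K := ℚ) (v.adicCompletion ℚ)) W n g hQ⟩ = pair n y ⟨Q, hQ⟩) →
            -- (P3) `pair` IS the `T₂E`-adic local Tate pairing: residues = the (D-layer) pairings for THE Weil pairings of the tree
            (∀ (n k : ℕ) (x : H1 (tateRep W 2) (κ.layerSubgroup n))
              (Q : localLayerPointsOfEmb κ (closureEmb (K := ℚ) (v.adicCompletion ℚ)) W n),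
              PadicInt.toZModPow k (pair n x Q) =
                LayerPairing.layerPairingPk W κ v (LayerPairing.weilTowerPk W) (LayerPairing.weilTowerPk_pow W)
                  (LayerPairing.weilTowerPk_add_left W) (LayerPairing.weilTowerPk_add_right W) (LayerPairing.weilTowerPk_smul W)
                  n k x Q) →
          ∃ (g : absoluteGaloisGroup (v.adicCompletion ℚ))
            (_ : κ.IsTopGenerator (resGalOfEmb (closureEmb (K := ℚ) (v.adicCompletion ℚ)) g))
            (d : ℕ → localPoints W (v.adicCompletion ℚ)) (s : I.H),
            (∀ n, d n ∈ localLayerPointsOfEmb κ (closureEmb (K := ℚ) (v.adicCompletion ℚ)) W n) ∧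
            (∀ n, localTraceOfEmb κ (closureEmb (K := ℚ) (v.adicCompletion ℚ)) W (n + 1) (n + 2) (d (n + 2)) = -d n) ∧
            (∀ n : ℕ, 1 ≤ n → ∀ P ∈ localLayerPointsOfEmb κ (closureEmb (K := ℚ) (v.adicCompletion ℚ)) W n,
              ∃ B ∈ AddSubgroup.closure (Set.range fun σ : absoluteGaloisGroup (v.adicCompletion ℚ) ↦ σ • d n),
                ∃ P' ∈ localLayerPointsOfEmb κ (closureEmb (K := ℚ) (v.adicCompletion ℚ)) W (n - 1),
                ∃ R ∈ localLayerPointsOfEmb κ (closureEmb (K := ℚ) (v.adicCompletion ℚ)) W n, P = B + P' + 2 • R) ∧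
            (∀ P ∈ localLayerPointsOfEmb κ (closureEmb (K := ℚ) (v.adicCompletion ℚ)) W 0,
              ∃ a : ℤ, ∃ R ∈ localLayerPointsOfEmb κ (closureEmb (K := ℚ) (v.adicCompletion ℚ)) W 0, P = a • d 0 + 2 • R) ∧
            Kato2004.IsEulerSystemClassTwo W hκ I s ∧
            (∀ col₀ : I.H →+ (localTowerPointsOfEmb κ (closureEmb (K := ℚ) (v.adicCompletion ℚ)) W →+ ℤ_[2]),
              (∀ (n : ℕ) (x : I.H) (Q : localPoints W (v.adicCompletion ℚ)) (hQ : Q ∈ localLayerPointsOfEmb κ (closureEmb (K := ℚ) (v.adicCompletion ℚ)) W n),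
                col₀ x ⟨Q, localLayerPointsOfEmb_le_localTowerPointsOfEmb κ (closureEmb (K := ℚ) (v.adicCompletion ℚ)) W n hQ⟩ = pair n (I.proj n x) ⟨Q, hQ⟩) →
              ∃ μ ν : IwasawaAlgebra 2, μ ∉ 𝔭.asIdeal ∧ ν ∉ 𝔭.asIdeal ∧
                ∀ (n : ℕ) (χ : DirichletCharacter ℂ_[2] (2 ^ (n + cyclotomicExponent 2))),
                  χ.Even → (∃ j : ℕ, orderOf χ = 2 ^ j) →
                  (∑' k, ((algebraMap ℚ_[2] ℂ_[2]).comp (algebraMap ℤ_[2] ℚ_[2])) (PowerSeries.coeff k ν) *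
                      (χ (cyclotomicGenerator 2 : ZMod (2 ^ (n + cyclotomicExponent 2))) - 1) ^ k) *
                    (∑' k, ((algebraMap ℚ_[2] ℂ_[2]).comp (algebraMap ℤ_[2] ℚ_[2]))
                        (PowerSeries.coeff k (pairingSum W (localTowerPointsOfEmb κ (closureEmb (K := ℚ) (v.adicCompletion ℚ)) W)
                          g n (d n) (col₀ s))) *
                      (χ (cyclotomicGenerator 2 : ZMod (2 ^ (n + cyclotomicExponent 2))) - 1) ^ k) =
                  (∑' k, ((algebraMap ℚ_[2] ℂ_[2]).comp (algebraMap ℤ_[2] ℚ_[2])) (PowerSeries.coeff k μ) *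
                      (χ (cyclotomicGenerator 2 : ZMod (2 ^ (n + cyclotomicExponent 2))) - 1) ^ k) *
                    ratTwistedSymbolSum f χ)) :
    ∀ (v : HeightOneSpectrum (𝓞 ℚ)), ((2 : ℕ) : 𝓞 ℚ) ∈ v.asIdeal →
    ∀ (W : WeierstrassCurve ℚ) [W.IsElliptic] [W.IsGloballyMinimal],
      ¬ W.HasCM → W.analyticRank = 0 → GoodSS W 2 → W.frobeniusTrace 2 = 0 →
      ∀ (κ : ZpExtension ℚ 2) (γ : Field.absoluteGaloisGroup ℚ) (hκ : κ.IsCyclotomic),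
        κ.IsTopGenerator γ → IsCyclotomicVariable 2 γ →
        ∀ [NeZero (W.conductorNorm ℤ)] (f : CuspForm (Gamma0 (W.conductorNorm ℤ)) 2),
          IsNewformOf W f → ∀ (ϖ : ℚ), (ϖ : ℝ) * W.realPeriodRat = plusPeriod f →
        ∀ (Lplus Lminus : IwasawaAlgebra 2), IsPollackPair f 2 Lplus Lminus →
        ∀ [ContinuousSMul ℤ_[2] (W.tateModule 2)] [Module.Free ℤ_[2] (W.tateModule 2)]
          [Module.Finite ℤ_[2] (W.tateModule 2)],
        ∀ 𝔭 : PrimeSpectrum (IwasawaAlgebra 2), 𝔭.asIdeal.height = 1 →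
          PowerSeries.C (2 : ℤ_[2]) ∉ 𝔭.asIdeal →
        ∀ (I : Kato2004.IwasawaH1Data W 2 κ γ)
          (pair : ∀ n : ℕ, H1 (tateRep W 2) (κ.layerSubgroup n) →ₗ[ℤ_[2]]
            (localLayerPointsOfEmb κ (closureEmb (K := ℚ) (v.adicCompletion ℚ)) W n →+ ℤ_[2])),
          -- (P1) projection formula
          (∀ (n : ℕ) (x : H1 (tateRep W 2) (κ.layerSubgroup (n + 1))) (Q : localPoints W (v.adicCompletion ℚ))
            (hQ : Q ∈ localLayerPointsOfEmb κ (closureEmb (K := ℚ) (v.adicCompletion ℚ)) W n),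
            pair n (layerCores (tateRep W 2) κ n x) ⟨Q, hQ⟩ =
              pair (n + 1) x ⟨Q, localLayerPointsOfEmb_mono κ (closureEmb (K := ℚ) (v.adicCompletion ℚ)) W (Nat.le_succ n) hQ⟩) →
          -- (P2) Galois invariance, for EVERY `g ∈ Γ_v`
          (∀ (n : ℕ) (g : absoluteGaloisGroup (v.adicCompletion ℚ)) (y : H1 (tateRep W 2) (κ.layerSubgroup n))
            (Q : localPoints W (v.adicCompletion ℚ))
            (hQ : Q ∈ localLayerPointsOfEmb κ (closureEmb (K := ℚ) (v.adicCompletion ℚ)) W n),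
            pair n (conjMap (tateRep W 2).toTopRep (κ.layerSubgroup n) (resGalOfEmb (closureEmb (K := ℚ) (v.adicCompletion ℚ)) g) 1 y)
              ⟨g • Q, smul_mem_localLayerPointsOfEmb κ (closureEmb (K := ℚ) (v.adicCompletion ℚ)) W n g hQ⟩ = pair n y ⟨Q, hQ⟩) →
          -- (P3) `pair` IS the `T₂E`-adic local Tate pairing: residues = the (D-layer) pairings for THE Weil pairings of the tree
          (∀ (n k : ℕ) (x : H1 (tateRep W 2) (κ.layerSubgroup n))
            (Q : localLayerPointsOfEmb κ (closureEmb (K := ℚ) (v.adicCompletion ℚ)) W n),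
            PadicInt.toZModPow k (pair n x Q) =
              LayerPairing.layerPairingPk W κ v (LayerPairing.weilTowerPk W) (LayerPairing.weilTowerPk_pow W)
                (LayerPairing.weilTowerPk_add_left W) (LayerPairing.weilTowerPk_add_right W) (LayerPairing.weilTowerPk_smul W)
                n k x Q) →
        ∃ (g : absoluteGaloisGroup (v.adicCompletion ℚ))
          (_ : κ.IsTopGenerator (resGalOfEmb (closureEmb (K := ℚ) (v.adicCompletion ℚ)) g))
          (d : ℕ → localPoints W (v.adicCompletion ℚ)) (s : I.H),
          (∀ n, d n ∈ localLayerPointsOfEmb κ (closureEmb (K := ℚ) (v.adicCompletion ℚ)) W n) ∧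
          (∀ n, localTraceOfEmb κ (closureEmb (K := ℚ) (v.adicCompletion ℚ)) W (n + 1) (n + 2) (d (n + 2)) = -d n) ∧
          (∀ n : ℕ, 1 ≤ n → ∀ P ∈ localLayerPointsOfEmb κ (closureEmb (K := ℚ) (v.adicCompletion ℚ)) W n,
            ∃ B ∈ AddSubgroup.closure (Set.range fun σ : absoluteGaloisGroup (v.adicCompletion ℚ) ↦ σ • d n),
              ∃ P' ∈ localLayerPointsOfEmb κ (closureEmb (K := ℚ) (v.adicCompletion ℚ)) W (n - 1),
              ∃ R ∈ localLayerPointsOfEmb κ (closureEmb (K := ℚ) (v.adicCompletion ℚ)) W n, P = B + P' + 2 • R) ∧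
          (∀ P ∈ localLayerPointsOfEmb κ (closureEmb (K := ℚ) (v.adicCompletion ℚ)) W 0,
            ∃ a : ℤ, ∃ R ∈ localLayerPointsOfEmb κ (closureEmb (K := ℚ) (v.adicCompletion ℚ)) W 0, P = a • d 0 + 2 • R) ∧
          Kato2004.IsEulerSystemClassTwo W hκ I s ∧
          (∀ col₀ : I.H →+ (localTowerPointsOfEmb κ (closureEmb (K := ℚ) (v.adicCompletion ℚ)) W →+ ℤ_[2]),
            (∀ (n : ℕ) (x : I.H) (Q : localPoints W (v.adicCompletion ℚ)) (hQ : Q ∈ localLayerPointsOfEmb κ (closureEmb (K := ℚ) (v.adicCompletion ℚ)) W n),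
              col₀ x ⟨Q, localLayerPointsOfEmb_le_localTowerPointsOfEmb κ (closureEmb (K := ℚ) (v.adicCompletion ℚ)) W n hQ⟩ = pair n (I.proj n x) ⟨Q, hQ⟩) →
            ∃ μ ν : IwasawaAlgebra 2, μ ∉ 𝔭.asIdeal ∧ ν ∉ 𝔭.asIdeal ∧
              ∀ n : ℕ, ∃ (m : ℕ) (q : IwasawaAlgebra 2),
                PowerSeries.C ((2 : ℚ_[2]) ^ m) *
                    (iwasawaToPowerSeries 2 μ * ((mazurTateElement f 2 n).map (algebraMap ℚ ℚ_[2]) : PowerSeries ℚ_[2]) -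
                      iwasawaToPowerSeries 2 (ν * pairingSum W (localTowerPointsOfEmb κ (closureEmb (K := ℚ) (v.adicCompletion ℚ)) W)
                        g n (d n) (col₀ s))) =
                  iwasawaToPowerSeries 2 (((cyclotomicOmega 2 n).map (Int.castRingHom ℤ_[2]) : PowerSeries ℤ_[2]) * q)) := by
  intro v hv W _ _ hcm hr hss ha κ γ hκ hγ hvar _ f hf ϖ hϖ Lplus Lminus hPol _ _ _ 𝔭 h𝔭 h2 I pair hP1 hP2 hP3
  obtain ⟨g, hg, d, s, hL, hTR, hGEN, hGEN0, hES, hCHI⟩ :=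
    hchi v hv W hcm hr hss ha κ γ hκ hγ hvar f hf ϖ hϖ Lplus Lminus hPol 𝔭 h𝔭 h2 I pair hP1 hP2 hP3
  refine ⟨g, hg, d, s, hL, hTR, hGEN, hGEN0, hES, fun col₀ hglue ↦ ?_⟩
  obtain ⟨μ, ν, hμ, hν, hval⟩ := hCHI col₀ hglue
  refine ⟨μ, ν, hμ, hν, fun n ↦ ?_⟩
  refine exists_C_pow_mul_sub_eq_omega_mul_of_forall_eval (p := 2) n (mazurTateElement f 2 n) μ
    (ν * pairingSum W (localTowerPointsOfEmb κ (closureEmb (K := ℚ) (v.adicCompletion ℚ)) W) g n (d n) (col₀ s))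
    fun ζ hζ ↦ ?_
  obtain ⟨χ, hev, hord, hχζ⟩ := exists_even_char_apply_cyclotomicGenerator_eq n hζ
  have hz : ‖ζ - 1‖ < 1 := norm_sub_one_lt_one_of_pow_prime_pow_eq_one hζ
  have hθ := eval₂_mazurTateElement_eq_ratTwistedSymbolSum f χ hev hord
  have h1 := hval n χ hev hord
  rw [hχζ] at hθ h1
  rw [hθ, ← h1, tsum_map_coeff_mul_mul_pow _ (hbd_two _) (hbd_two _) hz]

/-- **CORE_χ ⟸ CORE_fin** (the converse: the two sockets are EQUIVALENT). From the congruence (ERL_fin) at level `n`, evaluate at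
`χ(γ) − 1` (`forall_eval_of_C_pow_mul_sub_eq_omega_mul`; `χ(γ)^{2ⁿ} = 1` for an even character of `2`-power order modulo `2^{n+2}`)
and read `θ_n(χ(γ) − 1) = ratTwistedSymbolSum f χ` (Birch). CONDITIONAL on the hypothesis only; closes nothing by itself.
[cite: Pollack2003, Prop. 6.9 (proof), Prop. 6.18 (proof)] [cite: Washington1997, §7.2] -/
theorem coreChi_of_coreFin
    (hfin :
      ∀ (v : HeightOneSpectrum (𝓞 ℚ)), ((2 : ℕ) : 𝓞 ℚ) ∈ v.asIdeal →
      ∀ (W : WeierstrassCurve ℚ) [W.IsElliptic] [W.IsGloballyMinimal],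
        ¬ W.HasCM → W.analyticRank = 0 → GoodSS W 2 → W.frobeniusTrace 2 = 0 →
        ∀ (κ : ZpExtension ℚ 2) (γ : Field.absoluteGaloisGroup ℚ) (hκ : κ.IsCyclotomic),
          κ.IsTopGenerator γ → IsCyclotomicVariable 2 γ →
          ∀ [NeZero (W.conductorNorm ℤ)] (f : CuspForm (Gamma0 (W.conductorNorm ℤ)) 2),
            IsNewformOf W f → ∀ (ϖ : ℚ), (ϖ : ℝ) * W.realPeriodRat = plusPeriod f →
          ∀ (Lplus Lminus : IwasawaAlgebra 2), IsPollackPair f 2 Lplus Lminus →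
          ∀ [ContinuousSMul ℤ_[2] (W.tateModule 2)] [Module.Free ℤ_[2] (W.tateModule 2)]
            [Module.Finite ℤ_[2] (W.tateModule 2)],
          ∀ 𝔭 : PrimeSpectrum (IwasawaAlgebra 2), 𝔭.asIdeal.height = 1 →
            PowerSeries.C (2 : ℤ_[2]) ∉ 𝔭.asIdeal →
          ∀ (I : Kato2004.IwasawaH1Data W 2 κ γ)
            (pair : ∀ n : ℕ, H1 (tateRep W 2) (κ.layerSubgroup n) →ₗ[ℤ_[2]]
              (localLayerPointsOfEmb κ (closureEmb (K := ℚ) (v.adicCompletion ℚ)) W n →+ ℤ_[2])),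
            -- (P1) projection formula
            (∀ (n : ℕ) (x : H1 (tateRep W 2) (κ.layerSubgroup (n + 1))) (Q : localPoints W (v.adicCompletion ℚ))
              (hQ : Q ∈ localLayerPointsOfEmb κ (closureEmb (K := ℚ) (v.adicCompletion ℚ)) W n),
              pair n (layerCores (tateRep W 2) κ n x) ⟨Q, hQ⟩ =
                pair (n + 1) x ⟨Q, localLayerPointsOfEmb_mono κ (closureEmb (K := ℚ) (v.adicCompletion ℚ)) W (Nat.le_succ n) hQ⟩) →
            -- (P2) Galois invariance, for EVERY `g ∈ Γ_v`
            (∀ (n : ℕ) (g : absoluteGaloisGroup (v.adicCompletion ℚ)) (y : H1 (tateRep W 2) (κ.layerSubgroup n))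
              (Q : localPoints W (v.adicCompletion ℚ))
              (hQ : Q ∈ localLayerPointsOfEmb κ (closureEmb (K := ℚ) (v.adicCompletion ℚ)) W n),
              pair n (conjMap (tateRep W 2).toTopRep (κ.layerSubgroup n) (resGalOfEmb (closureEmb (K := ℚ) (v.adicCompletion ℚ)) g) 1 y)
                ⟨g • Q, smul_mem_localLayerPointsOfEmb κ (closureEmb (K := ℚ) (v.adicCompletion ℚ)) W n g hQ⟩ = pair n y ⟨Q, hQ⟩) →
            -- (P3) `pair` IS the `T₂E`-adic local Tate pairing: residues = the (D-layer) pairings for THE Weil pairings of the tree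
            (∀ (n k : ℕ) (x : H1 (tateRep W 2) (κ.layerSubgroup n))
              (Q : localLayerPointsOfEmb κ (closureEmb (K := ℚ) (v.adicCompletion ℚ)) W n),
              PadicInt.toZModPow k (pair n x Q) =
                LayerPairing.layerPairingPk W κ v (LayerPairing.weilTowerPk W) (LayerPairing.weilTowerPk_pow W)
                  (LayerPairing.weilTowerPk_add_left W) (LayerPairing.weilTowerPk_add_right W) (LayerPairing.weilTowerPk_smul W)
                  n k x Q) →
          ∃ (g : absoluteGaloisGroup (v.adicCompletion ℚ))
            (_ : κ.IsTopGenerator (resGalOfEmb (closureEmb (K := ℚ) (v.adicCompletion ℚ)) g))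
            (d : ℕ → localPoints W (v.adicCompletion ℚ)) (s : I.H),
            (∀ n, d n ∈ localLayerPointsOfEmb κ (closureEmb (K := ℚ) (v.adicCompletion ℚ)) W n) ∧
            (∀ n, localTraceOfEmb κ (closureEmb (K := ℚ) (v.adicCompletion ℚ)) W (n + 1) (n + 2) (d (n + 2)) = -d n) ∧
            (∀ n : ℕ, 1 ≤ n → ∀ P ∈ localLayerPointsOfEmb κ (closureEmb (K := ℚ) (v.adicCompletion ℚ)) W n,
              ∃ B ∈ AddSubgroup.closure (Set.range fun σ : absoluteGaloisGroup (v.adicCompletion ℚ) ↦ σ • d n),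
                ∃ P' ∈ localLayerPointsOfEmb κ (closureEmb (K := ℚ) (v.adicCompletion ℚ)) W (n - 1),
                ∃ R ∈ localLayerPointsOfEmb κ (closureEmb (K := ℚ) (v.adicCompletion ℚ)) W n, P = B + P' + 2 • R) ∧
            (∀ P ∈ localLayerPointsOfEmb κ (closureEmb (K := ℚ) (v.adicCompletion ℚ)) W 0,
              ∃ a : ℤ, ∃ R ∈ localLayerPointsOfEmb κ (closureEmb (K := ℚ) (v.adicCompletion ℚ)) W 0, P = a • d 0 + 2 • R) ∧
            Kato2004.IsEulerSystemClassTwo W hκ I s ∧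
            (∀ col₀ : I.H →+ (localTowerPointsOfEmb κ (closureEmb (K := ℚ) (v.adicCompletion ℚ)) W →+ ℤ_[2]),
              (∀ (n : ℕ) (x : I.H) (Q : localPoints W (v.adicCompletion ℚ)) (hQ : Q ∈ localLayerPointsOfEmb κ (closureEmb (K := ℚ) (v.adicCompletion ℚ)) W n),
                col₀ x ⟨Q, localLayerPointsOfEmb_le_localTowerPointsOfEmb κ (closureEmb (K := ℚ) (v.adicCompletion ℚ)) W n hQ⟩ = pair n (I.proj n x) ⟨Q, hQ⟩) →
              ∃ μ ν : IwasawaAlgebra 2, μ ∉ 𝔭.asIdeal ∧ ν ∉ 𝔭.asIdeal ∧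
                ∀ n : ℕ, ∃ (m : ℕ) (q : IwasawaAlgebra 2),
                  PowerSeries.C ((2 : ℚ_[2]) ^ m) *
                      (iwasawaToPowerSeries 2 μ * ((mazurTateElement f 2 n).map (algebraMap ℚ ℚ_[2]) : PowerSeries ℚ_[2]) -
                        iwasawaToPowerSeries 2 (ν * pairingSum W (localTowerPointsOfEmb κ (closureEmb (K := ℚ) (v.adicCompletion ℚ)) W)
                          g n (d n) (col₀ s))) =
                    iwasawaToPowerSeries 2 (((cyclotomicOmega 2 n).map (Int.castRingHom ℤ_[2]) : PowerSeries ℤ_[2]) * q))) :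
    ∀ (v : HeightOneSpectrum (𝓞 ℚ)), ((2 : ℕ) : 𝓞 ℚ) ∈ v.asIdeal →
    ∀ (W : WeierstrassCurve ℚ) [W.IsElliptic] [W.IsGloballyMinimal],
      ¬ W.HasCM → W.analyticRank = 0 → GoodSS W 2 → W.frobeniusTrace 2 = 0 →
      ∀ (κ : ZpExtension ℚ 2) (γ : Field.absoluteGaloisGroup ℚ) (hκ : κ.IsCyclotomic),
        κ.IsTopGenerator γ → IsCyclotomicVariable 2 γ →
        ∀ [NeZero (W.conductorNorm ℤ)] (f : CuspForm (Gamma0 (W.conductorNorm ℤ)) 2),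
          IsNewformOf W f → ∀ (ϖ : ℚ), (ϖ : ℝ) * W.realPeriodRat = plusPeriod f →
        ∀ (Lplus Lminus : IwasawaAlgebra 2), IsPollackPair f 2 Lplus Lminus →
        ∀ [ContinuousSMul ℤ_[2] (W.tateModule 2)] [Module.Free ℤ_[2] (W.tateModule 2)]
          [Module.Finite ℤ_[2] (W.tateModule 2)],
        ∀ 𝔭 : PrimeSpectrum (IwasawaAlgebra 2), 𝔭.asIdeal.height = 1 →
          PowerSeries.C (2 : ℤ_[2]) ∉ 𝔭.asIdeal →
        ∀ (I : Kato2004.IwasawaH1Data W 2 κ γ)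
          (pair : ∀ n : ℕ, H1 (tateRep W 2) (κ.layerSubgroup n) →ₗ[ℤ_[2]]
            (localLayerPointsOfEmb κ (closureEmb (K := ℚ) (v.adicCompletion ℚ)) W n →+ ℤ_[2])),
          -- (P1) projection formula
          (∀ (n : ℕ) (x : H1 (tateRep W 2) (κ.layerSubgroup (n + 1))) (Q : localPoints W (v.adicCompletion ℚ))
            (hQ : Q ∈ localLayerPointsOfEmb κ (closureEmb (K := ℚ) (v.adicCompletion ℚ)) W n),
            pair n (layerCores (tateRep W 2) κ n x) ⟨Q, hQ⟩ =
              pair (n + 1) x ⟨Q, localLayerPointsOfEmb_mono κ (closureEmb (K := ℚ) (v.adicCompletion ℚ)) W (Nat.le_succ n) hQ⟩) →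
          -- (P2) Galois invariance, for EVERY `g ∈ Γ_v`
          (∀ (n : ℕ) (g : absoluteGaloisGroup (v.adicCompletion ℚ)) (y : H1 (tateRep W 2) (κ.layerSubgroup n))
            (Q : localPoints W (v.adicCompletion ℚ))
            (hQ : Q ∈ localLayerPointsOfEmb κ (closureEmb (K := ℚ) (v.adicCompletion ℚ)) W n),
            pair n (conjMap (tateRep W 2).toTopRep (κ.layerSubgroup n) (resGalOfEmb (closureEmb (K := ℚ) (v.adicCompletion ℚ)) g) 1 y)
              ⟨g • Q, smul_mem_localLayerPointsOfEmb κ (closureEmb (K := ℚ) (v.adicCompletion ℚ)) W n g hQ⟩ = pair n y ⟨Q, hQ⟩) →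
          -- (P3) `pair` IS the `T₂E`-adic local Tate pairing: residues = the (D-layer) pairings for THE Weil pairings of the tree
          (∀ (n k : ℕ) (x : H1 (tateRep W 2) (κ.layerSubgroup n))
            (Q : localLayerPointsOfEmb κ (closureEmb (K := ℚ) (v.adicCompletion ℚ)) W n),
            PadicInt.toZModPow k (pair n x Q) =
              LayerPairing.layerPairingPk W κ v (LayerPairing.weilTowerPk W) (LayerPairing.weilTowerPk_pow W)
                (LayerPairing.weilTowerPk_add_left W) (LayerPairing.weilTowerPk_add_right W) (LayerPairing.weilTowerPk_smul W)
                n k x Q) →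
        ∃ (g : absoluteGaloisGroup (v.adicCompletion ℚ))
          (_ : κ.IsTopGenerator (resGalOfEmb (closureEmb (K := ℚ) (v.adicCompletion ℚ)) g))
          (d : ℕ → localPoints W (v.adicCompletion ℚ)) (s : I.H),
          (∀ n, d n ∈ localLayerPointsOfEmb κ (closureEmb (K := ℚ) (v.adicCompletion ℚ)) W n) ∧
          (∀ n, localTraceOfEmb κ (closureEmb (K := ℚ) (v.adicCompletion ℚ)) W (n + 1) (n + 2) (d (n + 2)) = -d n) ∧
          (∀ n : ℕ, 1 ≤ n → ∀ P ∈ localLayerPointsOfEmb κ (closureEmb (K := ℚ) (v.adicCompletion ℚ)) W n,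
            ∃ B ∈ AddSubgroup.closure (Set.range fun σ : absoluteGaloisGroup (v.adicCompletion ℚ) ↦ σ • d n),
              ∃ P' ∈ localLayerPointsOfEmb κ (closureEmb (K := ℚ) (v.adicCompletion ℚ)) W (n - 1),
              ∃ R ∈ localLayerPointsOfEmb κ (closureEmb (K := ℚ) (v.adicCompletion ℚ)) W n, P = B + P' + 2 • R) ∧
          (∀ P ∈ localLayerPointsOfEmb κ (closureEmb (K := ℚ) (v.adicCompletion ℚ)) W 0,
            ∃ a : ℤ, ∃ R ∈ localLayerPointsOfEmb κ (closureEmb (K := ℚ) (v.adicCompletion ℚ)) W 0, P = a • d 0 + 2 • R) ∧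
          Kato2004.IsEulerSystemClassTwo W hκ I s ∧
          (∀ col₀ : I.H →+ (localTowerPointsOfEmb κ (closureEmb (K := ℚ) (v.adicCompletion ℚ)) W →+ ℤ_[2]),
            (∀ (n : ℕ) (x : I.H) (Q : localPoints W (v.adicCompletion ℚ)) (hQ : Q ∈ localLayerPointsOfEmb κ (closureEmb (K := ℚ) (v.adicCompletion ℚ)) W n),
              col₀ x ⟨Q, localLayerPointsOfEmb_le_localTowerPointsOfEmb κ (closureEmb (K := ℚ) (v.adicCompletion ℚ)) W n hQ⟩ = pair n (I.proj n x) ⟨Q, hQ⟩) →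
            ∃ μ ν : IwasawaAlgebra 2, μ ∉ 𝔭.asIdeal ∧ ν ∉ 𝔭.asIdeal ∧
              ∀ (n : ℕ) (χ : DirichletCharacter ℂ_[2] (2 ^ (n + cyclotomicExponent 2))),
                χ.Even → (∃ j : ℕ, orderOf χ = 2 ^ j) →
                (∑' k, ((algebraMap ℚ_[2] ℂ_[2]).comp (algebraMap ℤ_[2] ℚ_[2])) (PowerSeries.coeff k ν) *
                    (χ (cyclotomicGenerator 2 : ZMod (2 ^ (n + cyclotomicExponent 2))) - 1) ^ k) *
                  (∑' k, ((algebraMap ℚ_[2] ℂ_[2]).comp (algebraMap ℤ_[2] ℚ_[2]))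
                      (PowerSeries.coeff k (pairingSum W (localTowerPointsOfEmb κ (closureEmb (K := ℚ) (v.adicCompletion ℚ)) W)
                        g n (d n) (col₀ s))) *
                    (χ (cyclotomicGenerator 2 : ZMod (2 ^ (n + cyclotomicExponent 2))) - 1) ^ k) =
                (∑' k, ((algebraMap ℚ_[2] ℂ_[2]).comp (algebraMap ℤ_[2] ℚ_[2])) (PowerSeries.coeff k μ) *
                    (χ (cyclotomicGenerator 2 : ZMod (2 ^ (n + cyclotomicExponent 2))) - 1) ^ k) *
                  ratTwistedSymbolSum f χ) := by
  intro v hv W _ _ hcm hr hss ha κ γ hκ hγ hvar _ f hf ϖ hϖ Lplus Lminus hPol _ _ _ 𝔭 h𝔭 h2 I pair hP1 hP2 hP3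
  obtain ⟨g, hg, d, s, hL, hTR, hGEN, hGEN0, hES, hFIN⟩ :=
    hfin v hv W hcm hr hss ha κ γ hκ hγ hvar f hf ϖ hϖ Lplus Lminus hPol 𝔭 h𝔭 h2 I pair hP1 hP2 hP3
  refine ⟨g, hg, d, s, hL, hTR, hGEN, hGEN0, hES, fun col₀ hglue ↦ ?_⟩
  obtain ⟨μ, ν, hμ, hν, hcongr⟩ := hFIN col₀ hglue
  refine ⟨μ, ν, hμ, hν, fun n χ hev hord ↦ ?_⟩
  obtain ⟨m, q, hmq⟩ := hcongr n
  set ζ : ℂ_[2] := χ (cyclotomicGenerator 2 : ZMod (2 ^ (n + cyclotomicExponent 2))) with hζdef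
  -- `ζ^{2ⁿ} = 1`: `γ = 5` has order `2ⁿ` modulo `2^{n+2}`
  have hζ : ζ ^ 2 ^ n = 1 := by
    have hγ : (cyclotomicGenerator 2 : ZMod (2 ^ (n + cyclotomicExponent 2))) ^ 2 ^ n = 1 := by
      have h := pow_orderOf_eq_one (cyclotomicGenerator 2 : ZMod (2 ^ (n + cyclotomicExponent 2)))
      rwa [orderOf_cyclotomicGenerator 2 n] at h
    rw [hζdef, ← map_pow, hγ, map_one]
  have hz : ‖ζ - 1‖ < 1 := norm_sub_one_lt_one_of_pow_prime_pow_eq_one hζ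
  have hθ := eval₂_mazurTateElement_eq_ratTwistedSymbolSum f χ hev hord
  have h1 := forall_eval_of_C_pow_mul_sub_eq_omega_mul (p := 2) n (mazurTateElement f 2 n) μ
    (ν * pairingSum W (localTowerPointsOfEmb κ (closureEmb (K := ℚ) (v.adicCompletion ℚ)) W) g n (d n) (col₀ s)) hmq ζ hζ
  rw [← hζdef] at hθ
  rw [hθ, tsum_map_coeff_mul_mul_pow _ (hbd_two _) (hbd_two _) hz] at h1
  exact h1.symm

end Socket

end Summit.BirchSwinnertonDyer.BirchSwinnertonDyer.Theorems.SignedKatoOffTwo.CoreChi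

end
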